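import Literature.Analysis.FluidPDE.TorusNSStrainDirectionCriterion
import Literature.Analysis.FunctionSpaces.TorusInverseLaplacianCalculus
import HarnessLib

/-!
# Two-component equivalence: the third strain column and the horizontal vorticity have
# equivalent `L^p(𝕋³)` norms (Miller, Nonlinearity 33 (2020), Prop 3.6 = thesis Prop 6.6)

search for candidate a priori estimates; no regularity claim.

Analysis/FluidPDE proof file (theorems only; no definitions, no named facts). Miller's
"two component equivalence" (Nonlinearity 33 (2020) 5272–5323, Prop 3.6; PhD thesis 2020,
Prop 6.6): "Fix `1 < q < +∞` and let `B_q ≥ 1` be the constant from the Helmholtz decomposition.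
Then for all `u ∈ Ẇ^{1,q}_{df}(ℝ³)`, `(1/2B_q)‖ω_h‖_{L^q} ≤ ‖v³‖_{L^q} ≤ 2B_q‖ω_h‖_{L^q}`", where
`v³ = ∂₃u + ∇u₃ = 2 S e₃` is (twice) the third column of the strain and `ω_h = (ω₁, ω₂, 0)` the
horizontal vorticity; printed proof: `∂₃u − ∇u₃ = (ω₂, −ω₁, 0)` pointwise ((6.27) of the thesis),
`∂₃u = P_df(v³)`, `∇u₃ = P_g(v³)` and the `L^q` bounds of the Helmholtz projections.

Here on the unit three-torus `𝕋³ = UnitAddTorus (Fin 3)` (indices `0, 1, 2`; vertical direction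
`e₂`), for smooth divergence-free `u` with `ω = curl u` (`BDSV.curl`) and
`vⱼ = (∂₂u)ⱼ + ∂ⱼu₂`, `1 < p < ∞`, componentwise `L^p` norms:

* `BDSV.exists_eLpNorm_partialDeriv_vertical_le_strainColumn` — **`‖∇u₃‖_{L^q} ≤ B_q‖v³‖_{L^q}`**
  (thesis (6.33)): `‖∂ᵢu₂‖_{L^p} ≤ C ∑ⱼ ‖vⱼ‖_{L^p}`. PROOF (the periodic Helmholtz bound made
  explicit): `div v = ∂₂(div u) + Δu₂ = Δu₂`, so `u₂ − ∫u₂ = Δ⁻¹(∑ⱼ∂ⱼvⱼ) = ∑ⱼ ∂ⱼΔ⁻¹vⱼ` and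
  `∂ᵢu₂ = ∑ⱼ ∂ᵢ∂ⱼΔ⁻¹vⱼ`; each term is bounded by the periodic Calderón–Zygmund (Hessian) bound
  `Torus.eLpNorm_hessian_le_laplacian_holds_fin3` since `ΔΔ⁻¹vⱼ = vⱼ` (`∫vⱼ = 0`).
* `BDSV.exists_eLpNorm_horizontal_curl_le_strainColumn` — **the first inequality of Prop 3.6,
  `‖ω_h‖_{L^q} ≤ 2B_q‖v³‖_{L^q}`**: `‖ω₀‖_{L^p}, ‖ω₁‖_{L^p} ≤ C ∑ⱼ ‖vⱼ‖_{L^p}`, from the pointwise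
  identities `ω₀ = 2∂₁u₂ − v₁`, `ω₁ = v₀ − 2∂₀u₂` (i.e. (6.27)) and the previous bound.
* `BDSV.exists_twoComponent_equivalence` — **Prop 3.6 both ways**: one constant `B` with
  `‖ω₀‖_{L^p} + ‖ω₁‖_{L^p} ≤ B ∑ⱼ‖vⱼ‖_{L^p}` and `∑ⱼ‖vⱼ‖_{L^p} ≤ B(‖ω₀‖_{L^p} + ‖ω₁‖_{L^p})`,
  the second inequality being the tree's `BDSV.exists_eLpNorm_strainColumn_le_horizontal_curl`
  (`TorusNSStrainDirectionCriterion` §6, stated there for `(S e₂)ᵢ = vᵢ/2`).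

Consequence for the cell's CRITERIA table: on `𝕋³` the hypotheses of Miller's fixed-direction
criterion (`Torus.classicalNS_continuation_of_strainColumn_Lq_rpow_integral_le`, `k = 2`) and of
Chae–Choe's two-component criterion (`Torus.classicalNS_continuation_of_horizontalVorticity_…`)
majorise each other up to constants, as asserted after Cor 5.8 of Miller ARMA 2020 ("equivalent
to Chae and Choe's result … for `3/2 < q < +∞`").

Scope (faithfulness): `𝕋³` instead of `ℝ³` (the Helmholtz/Riesz bounds are the periodic ones of
`TorusRieszTransformProofs`); smooth divergence-free fields instead of `Ẇ^{1,q}_{df}`;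
componentwise `L^p` norms (`∑ⱼ‖vⱼ‖_{L^p}`, `‖ω₀‖_{L^p} + ‖ω₁‖_{L^p}`) instead of the `L^p` norm of
the Euclidean length, which changes `B_q` by dimensional factors only; constants inexplicit.
-- TODO(general form): vector-valued `L^p` norms with the printed constants `1/(2B_q)`, `2B_q`.

## Mathlib / tree search

Reused: `Torus.eLpNorm_hessian_le_laplacian_holds_fin3` (`TorusRieszTransformProofs`),
`Torus.laplacian_invLaplacian`, `Torus.invLaplacian_laplacian`, `Torus.partialDeriv_invLaplacian`,
`Torus.invLaplacian_finset_sum`, `Torus.isSmooth_invLaplacian` (`TorusInverseLaplacian(Calculus)`),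
`Torus.laplacian_eq_sum_partialDeriv_partialDeriv`, `Torus.partialDeriv_comm`,
`Torus.divergence_eq_sum_partialDeriv_apply`, `Torus.partialDeriv_apply_coord`,
`Torus.partialDeriv_finset_sum`, `Torus.partialDeriv_add`, `Torus.integral_partialDeriv_eq_zero_holds`,
`BDSV.curl_apply_zero/one`, `BDSV.exists_eLpNorm_strainColumn_le_horizontal_curl`; Mathlib
`eLpNorm_sum_le`, `eLpNorm_add_le`, `eLpNorm_sub_le`. Searched (`lean search
'horizontal_curl_le|le_strainColumn|twoComponent'`): only the upper direction
(`exists_eLpNorm_partialDeriv_vertical_le_horizontal_curl`, `exists_eLpNorm_strainColumn_le_horizontal_curl`)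
is in the tree; the lower one is new.

## References

* E. Miller, *Global regularity for solutions of the three dimensional Navier–Stokes equation
  with almost two dimensional initial data*, Nonlinearity 33 (2020) 5272–5323 (arXiv:1909.09125),
  Prop 3.6 and Prop 1.4 (held: paper:arxiv-1909.09125, p. 11 resp. p. 4 of the text).
  [Miller2020AlmostTwoDimensional]
* E. Miller, *The Navier–Stokes strain equation with applications to enstrophy growth and global
  regularity*, PhD thesis, Univ. Toronto 2020, Prop 6.6 with (6.26)–(6.34) (held:
  paper:w2999963731, p. 48). [Miller2020PhD]
* E. Miller, *A regularity criterion for the Navier–Stokes equation involving only the middle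
  eigenvalue of the strain tensor*, ARMA 235 (2020), discussion after Cor 5.8. [Miller2019]
* A. J. Majda, A. L. Bertozzi, *Vorticity and Incompressible Flow*, CUP 2002, §11.1 (11.9)
  (Calderón–Zygmund). [MajdaBertozziCUP2002]
-/

noncomputable section

open MeasureTheory Set Filter Function
open scoped ENNReal NNReal

namespace Literature.Analysis.FluidPDE

namespace BDSV

open FunctionSpaces FunctionSpaces.Torus

variable {u : UnitAddTorus (Fin 3) → EuclideanSpace ℝ (Fin 3)}

/-! ## §1 `∂ᵢu₂ = ∑ⱼ ∂ᵢ∂ⱼ Δ⁻¹ vⱼ`, `vⱼ = (∂₂u)ⱼ + ∂ⱼu₂` -/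

/-- The components `vⱼ = (∂₂u)ⱼ + ∂ⱼu₂` of `v = ∂₂u + ∇u₂` are smooth. [folklore] -/
private theorem isSmooth_strainColumnTwice (hu : IsSmooth u) (j : Fin 3) :
    IsSmooth fun y => Torus.partialDeriv 2 u y j + Torus.partialDeriv j u y 2 := by
  have hu1 : IsContDiff 1 u := hu.isContDiff (by simp)
  have e : (fun y => Torus.partialDeriv 2 u y j + Torus.partialDeriv j u y 2) =
      Torus.partialDeriv 2 (fun y => u y j) + Torus.partialDeriv j (fun y => u y 2) := by
    funext y
    simp only [Pi.add_apply]
    rw [partialDeriv_apply_coord hu1 2 y j, partialDeriv_apply_coord hu1 j y 2]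
  rw [e]
  exact ((hu.apply j).partialDeriv 2).add ((hu.apply 2).partialDeriv j)

/-- `∫ vⱼ = 0`: each `vⱼ` is a sum of partial derivatives. [folklore] -/
private theorem integral_strainColumnTwice (hu : IsSmooth u) (j : Fin 3) :
    ∫ y, (Torus.partialDeriv 2 u y j + Torus.partialDeriv j u y 2) = 0 := by
  have hu1 : IsContDiff 1 u := hu.isContDiff (by simp)
  have hint : ∀ i k : Fin 3, ∫ y, Torus.partialDeriv i u y k = 0 := fun i k => by
    have h := integral_partialDeriv_eq_zero_holds (hu.apply k) i
    simp_rw [partialDeriv_apply_coord hu1] at h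
    exact h
  have hI : ∀ i k : Fin 3, Integrable (fun y => Torus.partialDeriv i u y k) volume := fun i k =>
    ((hu.partialDeriv i).apply k).integrable
  rw [integral_add (hI 2 j) (hI j 2), hint, hint, add_zero]

/-- `div v = Δu₂` for `v = ∂₂u + ∇u₂` and divergence-free `u`:
`∑ⱼ ∂ⱼvⱼ = ∂₂(div u) + Δu₂ = Δu₂`. [folklore] -/
private theorem sum_partialDeriv_strainColumnTwice (hu : IsSmooth u) (hdiv : IsDivFree u)
    (y : UnitAddTorus (Fin 3)) :
    ∑ j : Fin 3, Torus.partialDeriv j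
        (fun z => Torus.partialDeriv 2 u z j + Torus.partialDeriv j u z 2) y =
      Torus.laplacian (fun z => u z 2) y := by
  have hu1 : IsContDiff 1 u := hu.isContDiff (by simp)
  have hφ : IsSmooth (fun z => u z 2) := hu.apply 2
  have h1 : ∀ j : Fin 3, Torus.partialDeriv j
      (fun z => Torus.partialDeriv 2 u z j + Torus.partialDeriv j u z 2) y =
        Torus.partialDeriv 2 (Torus.partialDeriv j (fun z => u z j)) y +
          Torus.partialDeriv j (Torus.partialDeriv j (fun z => u z 2)) y := by
    intro j
    have e : (fun z => Torus.partialDeriv 2 u z j + Torus.partialDeriv j u z 2) =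
        Torus.partialDeriv 2 (fun z => u z j) + Torus.partialDeriv j (fun z => u z 2) := by
      funext z
      simp only [Pi.add_apply]
      rw [partialDeriv_apply_coord hu1 2 z j, partialDeriv_apply_coord hu1 j z 2]
    rw [e, partialDeriv_add (((hu.apply j).partialDeriv 2).isContDiff (by simp))
      ((hφ.partialDeriv j).isContDiff (by simp)), Pi.add_apply,
      Torus.partialDeriv_comm (hu.apply j) j 2 y]
  simp_rw [h1]
  rw [Finset.sum_add_distrib, ← laplacian_eq_sum_partialDeriv_partialDeriv hφ y]
  -- `∑ⱼ ∂₂∂ⱼuⱼ = ∂₂ (div u) = 0`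
  have hsum : ∑ j : Fin 3, Torus.partialDeriv 2 (Torus.partialDeriv j (fun z => u z j)) y =
      Torus.partialDeriv 2 (fun z => ∑ j : Fin 3, Torus.partialDeriv j (fun w => u w j) z) y := by
    rw [partialDeriv_finset_sum Finset.univ
      (fun j _ => ((hu.apply j).partialDeriv j).isContDiff (by simp))]
  have hdiv' : (fun z => ∑ j : Fin 3, Torus.partialDeriv j (fun w => u w j) z) =
      fun _ => (0 : ℝ) := by
    funext z
    exact hdiv z
  rw [hsum, hdiv']
  simp [Torus.partialDeriv, Torus.lineDeriv]

/-- **`∂ᵢu₂ = ∑ⱼ ∂ᵢ∂ⱼΔ⁻¹vⱼ`** pointwise, for smooth divergence-free `u` on `𝕋³`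
(`u₂ − ∫u₂ = Δ⁻¹Δu₂ = Δ⁻¹ div v = ∑ⱼ ∂ⱼΔ⁻¹vⱼ`). [folklore] -/
private theorem partialDeriv_vertical_eq_sum_hessian_invLaplacian (hu : IsSmooth u)
    (hdiv : IsDivFree u) (i : Fin 3) (x : UnitAddTorus (Fin 3)) :
    Torus.partialDeriv i u x 2 = ∑ j : Fin 3, Torus.partialDeriv i (Torus.partialDeriv j
      (invLaplacian fun y => Torus.partialDeriv 2 u y j + Torus.partialDeriv j u y 2)) x := by
  have hu1 : IsContDiff 1 u := hu.isContDiff (by simp)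
  have hφ : IsSmooth (fun z => u z 2) := hu.apply 2
  have hvs := isSmooth_strainColumnTwice hu
  -- `u₂ − ∫u₂ = ∑ⱼ ∂ⱼ Δ⁻¹ vⱼ`
  have hstep : (fun y => u y 2 - ∫ z, u z 2) = fun y => ∑ j : Fin 3, Torus.partialDeriv j
      (invLaplacian fun z => Torus.partialDeriv 2 u z j + Torus.partialDeriv j u z 2) y := by
    funext y
    rw [← invLaplacian_laplacian hφ y]
    have hlap : Torus.laplacian (fun z => u z 2) = ∑ j : Fin 3, Torus.partialDeriv j
        (fun z => Torus.partialDeriv 2 u z j + Torus.partialDeriv j u z 2) := by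
      funext z
      rw [Finset.sum_apply]
      exact (sum_partialDeriv_strainColumnTwice hu hdiv z).symm
    rw [hlap, invLaplacian_finset_sum Finset.univ (fun j _ => (hvs j).partialDeriv j),
      Finset.sum_apply]
    exact Finset.sum_congr rfl fun j _ => (partialDeriv_invLaplacian (hvs j) j y).symm
  have hsub : Torus.partialDeriv i (fun y => u y 2 - ∫ z, u z 2) x =
      Torus.partialDeriv i (fun y => u y 2) x := by
    simp only [Torus.partialDeriv, Torus.lineDeriv, deriv_sub_const]
  rw [← partialDeriv_apply_coord hu1 i x 2, ← hsub, hstep,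
    partialDeriv_finset_sum Finset.univ (fun j _ =>
      ((isSmooth_invLaplacian (hvs j)).partialDeriv j).isContDiff (by simp))]

/-! ## §2 The gradient of the vertical velocity is controlled by the third strain column -/

/-- **`‖∇u₃‖_{L^q} ≤ B_q‖∂₃u + ∇u₃‖_{L^q}` on `𝕋³`** (Miller, thesis 2020, (6.33); Nonlinearity
2020, proof of Prop 3.6: "`∇u₃ = P_g v³`", Helmholtz bound Prop 1.4): for every `1 < p < ∞` there
is `C` with `‖∂ᵢu₂‖_{L^p} ≤ C ∑ⱼ ‖(∂₂u)ⱼ + ∂ⱼu₂‖_{L^p}` for all smooth divergence-free `u` on `𝕋³`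
and all `i` (indices `0, 1, 2`). Proof: `∂ᵢu₂ = ∑ⱼ ∂ᵢ∂ⱼΔ⁻¹vⱼ` and the periodic Hessian bound
`‖∂ᵢ∂ⱼΔ⁻¹vⱼ‖_{L^p} ≤ C‖ΔΔ⁻¹vⱼ‖_{L^p} = C‖vⱼ‖_{L^p}` (`∫vⱼ = 0`).
[cite: Miller2020AlmostTwoDimensional, Prop 3.6 (proof, ∇u₃ = P_g v³) with Prop 1.4] -/
theorem exists_eLpNorm_partialDeriv_vertical_le_strainColumn {p : ℝ≥0∞} (hp1 : 1 < p)
    (hp : p < ⊤) :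
    ∃ C : ℝ≥0, ∀ u : UnitAddTorus (Fin 3) → EuclideanSpace ℝ (Fin 3), IsSmooth u → IsDivFree u →
      ∀ i : Fin 3, eLpNorm (fun x => Torus.partialDeriv i u x 2) p volume ≤
        C * ∑ j : Fin 3, eLpNorm (fun x => Torus.partialDeriv 2 u x j + Torus.partialDeriv j u x 2)
          p volume := by
  obtain ⟨C, hC⟩ := eLpNorm_hessian_le_laplacian_holds_fin3 p hp1 hp
  refine ⟨C, fun u hu hdiv i => ?_⟩
  set v : Fin 3 → UnitAddTorus (Fin 3) → ℝ := fun j y =>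
    Torus.partialDeriv 2 u y j + Torus.partialDeriv j u y 2 with hv
  have hvs : ∀ j, IsSmooth (v j) := fun j => isSmooth_strainColumnTwice hu j
  -- `g j = ∂ᵢ∂ⱼΔ⁻¹ vⱼ`
  set g : Fin 3 → UnitAddTorus (Fin 3) → ℝ := fun j =>
    Torus.partialDeriv i (Torus.partialDeriv j (invLaplacian (v j))) with hg
  have hg_meas : ∀ j, AEStronglyMeasurable (g j) volume := fun j =>
    (((isSmooth_invLaplacian (hvs j)).partialDeriv j).partialDeriv i).continuous.aestronglyMeasurable
  have hgb : ∀ j, eLpNorm (g j) p volume ≤ C * eLpNorm (v j) p volume := by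
    intro j
    have hlap : Torus.laplacian (invLaplacian (v j)) = v j := by
      funext x
      rw [laplacian_invLaplacian (hvs j) x]
      have h0 : ∫ y, v j y = 0 := integral_strainColumnTwice hu j
      rw [h0, sub_zero]
    have h1 := hC (invLaplacian (v j)) (isSmooth_invLaplacian (hvs j)) i j
    rw [hlap] at h1
    exact h1
  have hfun : (fun x => Torus.partialDeriv i u x 2) = ∑ j : Fin 3, g j := by
    funext x
    rw [partialDeriv_vertical_eq_sum_hessian_invLaplacian hu hdiv i x, Finset.sum_apply]
  rw [hfun]
  calc eLpNorm (∑ j : Fin 3, g j) p volume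
      ≤ ∑ j : Fin 3, eLpNorm (g j) p volume := eLpNorm_sum_le (fun j _ => hg_meas j) hp1.le
    _ ≤ ∑ j : Fin 3, C * eLpNorm (v j) p volume := Finset.sum_le_sum fun j _ => hgb j
    _ = C * ∑ j : Fin 3, eLpNorm (v j) p volume := by rw [Finset.mul_sum]

/-! ## §3 The horizontal vorticity is controlled by the third strain column -/

/-- **Miller's two-component equivalence, first inequality: `‖ω_h‖_{L^q} ≤ 2B_q‖∂₃u + ∇u₃‖_{L^q}`
on `𝕋³`** (Nonlinearity 2020 Prop 3.6 = thesis Prop 6.6, via (6.27) `∂₃u − ∇u₃ = (ω₂, −ω₁, 0)`):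
for every `1 < p < ∞` there is `C` with `‖ω_l‖_{L^p} ≤ C ∑ⱼ ‖(∂₂u)ⱼ + ∂ⱼu₂‖_{L^p}` for the two
horizontal components `l = 0, 1` of `ω = curl u`, all smooth divergence-free `u` on `𝕋³`.
Proof: `ω₀ = 2∂₁u₂ − v₁`, `ω₁ = v₀ − 2∂₀u₂` pointwise and
`exists_eLpNorm_partialDeriv_vertical_le_strainColumn`.
[cite: Miller2020AlmostTwoDimensional, Prop 3.6 (first inequality)] -/
theorem exists_eLpNorm_horizontal_curl_le_strainColumn {p : ℝ≥0∞} (hp1 : 1 < p) (hp : p < ⊤) :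
    ∃ C : ℝ≥0, ∀ u : UnitAddTorus (Fin 3) → EuclideanSpace ℝ (Fin 3), IsSmooth u → IsDivFree u →
      ∀ l : Fin 3, l ≠ 2 → eLpNorm (fun x => curl u x l) p volume ≤
        C * ∑ j : Fin 3, eLpNorm (fun x => Torus.partialDeriv 2 u x j + Torus.partialDeriv j u x 2)
          p volume := by
  obtain ⟨C, hC⟩ := exists_eLpNorm_partialDeriv_vertical_le_strainColumn hp1 hp
  refine ⟨1 + 2 * C, fun u hu hdiv l hl => ?_⟩
  set V : ℝ≥0∞ := ∑ j : Fin 3,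
    eLpNorm (fun x => Torus.partialDeriv 2 u x j + Torus.partialDeriv j u x 2) p volume with hV
  have hvs : ∀ j, IsSmooth (fun y => Torus.partialDeriv 2 u y j + Torus.partialDeriv j u y 2) :=
    fun j => isSmooth_strainColumnTwice hu j
  have hvm : ∀ j, AEStronglyMeasurable
      (fun y => Torus.partialDeriv 2 u y j + Torus.partialDeriv j u y 2) volume := fun j =>
    (hvs j).continuous.aestronglyMeasurable
  have hdm : ∀ i, AEStronglyMeasurable (fun y => Torus.partialDeriv i u y 2) volume := fun i =>
    ((hu.partialDeriv i).apply 2).continuous.aestronglyMeasurable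
  have hvle : ∀ j, eLpNorm (fun x => Torus.partialDeriv 2 u x j + Torus.partialDeriv j u x 2)
      p volume ≤ V := fun j => by
    rw [hV]
    exact Finset.single_le_sum (f := fun j => eLpNorm
      (fun x => Torus.partialDeriv 2 u x j + Torus.partialDeriv j u x 2) p volume)
      (fun _ _ => zero_le) (Finset.mem_univ j)
  -- `‖2 ∂ᵢu₂‖ ≤ 2 C V`
  have htwo : ∀ i, eLpNorm (fun x => 2 * Torus.partialDeriv i u x 2) p volume ≤ 2 * C * V := by
    intro i
    have e : (fun x => 2 * Torus.partialDeriv i u x 2) =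
        (fun x => Torus.partialDeriv i u x 2) + fun x => Torus.partialDeriv i u x 2 := by
      funext x; simp only [Pi.add_apply]; ring
    rw [e]
    calc eLpNorm ((fun x => Torus.partialDeriv i u x 2) + fun x => Torus.partialDeriv i u x 2) p volume
        ≤ eLpNorm (fun x => Torus.partialDeriv i u x 2) p volume +
            eLpNorm (fun x => Torus.partialDeriv i u x 2) p volume :=
          eLpNorm_add_le (hdm i) (hdm i) hp1.le
      _ ≤ C * V + C * V := add_le_add (hC u hu hdiv i) (hC u hu hdiv i)
      _ = 2 * C * V := by ring
  have hfin : 2 * C * V + V = ((1 + 2 * C : ℝ≥0) : ℝ≥0∞) * V := by push_cast; ring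
  fin_cases l
  · -- `ω₀ = ∂₁u₂ − ∂₂u₁ = 2∂₁u₂ − v₁`
    have e : (fun x => curl u x 0) = (fun x => 2 * Torus.partialDeriv 1 u x 2) -
        fun x => Torus.partialDeriv 2 u x 1 + Torus.partialDeriv 1 u x 2 := by
      funext x
      simp only [Pi.sub_apply, curl_apply_zero]
      ring
    show eLpNorm (fun x => curl u x 0) p volume ≤ ((1 + 2 * C : ℝ≥0) : ℝ≥0∞) * V
    rw [e, ← hfin]
    calc eLpNorm ((fun x => 2 * Torus.partialDeriv 1 u x 2) -
          fun x => Torus.partialDeriv 2 u x 1 + Torus.partialDeriv 1 u x 2) p volume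
        ≤ eLpNorm (fun x => 2 * Torus.partialDeriv 1 u x 2) p volume +
            eLpNorm (fun x => Torus.partialDeriv 2 u x 1 + Torus.partialDeriv 1 u x 2) p volume :=
          eLpNorm_sub_le ((hdm 1).const_mul 2) (hvm 1) hp1.le
      _ ≤ 2 * C * V + V := add_le_add (htwo 1) (hvle 1)
  · -- `ω₁ = ∂₂u₀ − ∂₀u₂ = v₀ − 2∂₀u₂`
    have e : (fun x => curl u x 1) =
        (fun x => Torus.partialDeriv 2 u x 0 + Torus.partialDeriv 0 u x 2) -
          fun x => 2 * Torus.partialDeriv 0 u x 2 := by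
      funext x
      simp only [Pi.sub_apply, curl_apply_one]
      ring
    show eLpNorm (fun x => curl u x 1) p volume ≤ ((1 + 2 * C : ℝ≥0) : ℝ≥0∞) * V
    rw [e, ← hfin]
    calc eLpNorm ((fun x => Torus.partialDeriv 2 u x 0 + Torus.partialDeriv 0 u x 2) -
          fun x => 2 * Torus.partialDeriv 0 u x 2) p volume
        ≤ eLpNorm (fun x => Torus.partialDeriv 2 u x 0 + Torus.partialDeriv 0 u x 2) p volume +
            eLpNorm (fun x => 2 * Torus.partialDeriv 0 u x 2) p volume :=
          eLpNorm_sub_le (hvm 0) ((hdm 0).const_mul 2) hp1.le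
      _ ≤ V + 2 * C * V := add_le_add (hvle 0) (htwo 0)
      _ = 2 * C * V + V := add_comm _ _
  · exact absurd rfl hl

/-! ## §4 Prop 3.6 both ways -/

/-- **Miller, Nonlinearity 33 (2020), Prop 3.6 (two component equivalence) = thesis Prop 6.6,
on `𝕋³`, componentwise norms**: "Fix `1 < q < +∞` and let `B_q ≥ 1` be the constant from the
Helmholtz decomposition. Then for all `u ∈ Ẇ^{1,q}_{df}(ℝ³)`,
`(1/2B_q)‖ω_h‖_{L^q} ≤ ‖v³‖_{L^q} ≤ 2B_q‖ω_h‖_{L^q}`", `v³ = ∂₃u + ∇u₃`. Here: for `1 < p < ∞`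
there is `B` such that for all smooth divergence-free `u` on `𝕋³`, with
`vⱼ = (∂₂u)ⱼ + ∂ⱼu₂` and `ω = curl u`,
`‖ω₀‖_{L^p} + ‖ω₁‖_{L^p} ≤ B ∑ⱼ ‖vⱼ‖_{L^p}` and `∑ⱼ ‖vⱼ‖_{L^p} ≤ B (‖ω₀‖_{L^p} + ‖ω₁‖_{L^p})`
(the second from `exists_eLpNorm_strainColumn_le_horizontal_curl`, `vⱼ = 2(S e₂)ⱼ`).
[cite: Miller2020AlmostTwoDimensional, Prop 3.6] -/
theorem exists_twoComponent_equivalence {p : ℝ≥0∞} (hp1 : 1 < p) (hp : p < ⊤) :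
    ∃ B : ℝ≥0, ∀ u : UnitAddTorus (Fin 3) → EuclideanSpace ℝ (Fin 3), IsSmooth u → IsDivFree u →
      eLpNorm (fun x => curl u x 0) p volume + eLpNorm (fun x => curl u x 1) p volume ≤
          B * ∑ j : Fin 3, eLpNorm
            (fun x => Torus.partialDeriv 2 u x j + Torus.partialDeriv j u x 2) p volume ∧
        ∑ j : Fin 3, eLpNorm (fun x => Torus.partialDeriv 2 u x j + Torus.partialDeriv j u x 2)
            p volume ≤
          B * (eLpNorm (fun x => curl u x 0) p volume + eLpNorm (fun x => curl u x 1) p volume) := by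
  obtain ⟨C₁, hC₁⟩ := exists_eLpNorm_horizontal_curl_le_strainColumn hp1 hp
  obtain ⟨C₂, hC₂⟩ := exists_eLpNorm_strainColumn_le_horizontal_curl hp1 hp
  refine ⟨2 * C₁ + 6 * C₂, fun u hu hdiv => ⟨?_, ?_⟩⟩
  · set V : ℝ≥0∞ := ∑ j : Fin 3,
      eLpNorm (fun x => Torus.partialDeriv 2 u x j + Torus.partialDeriv j u x 2) p volume
    calc eLpNorm (fun x => curl u x 0) p volume + eLpNorm (fun x => curl u x 1) p volume
        ≤ C₁ * V + C₁ * V :=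
          add_le_add (hC₁ u hu hdiv 0 (by decide)) (hC₁ u hu hdiv 1 (by decide))
      _ = ((2 * C₁ : ℝ≥0) : ℝ≥0∞) * V := by push_cast; ring
      _ ≤ ((2 * C₁ + 6 * C₂ : ℝ≥0) : ℝ≥0∞) * V := by
          gcongr
          exact_mod_cast (le_add_of_nonneg_right (by positivity) : 2 * C₁ ≤ 2 * C₁ + 6 * C₂)
  · set W : ℝ≥0∞ := eLpNorm (fun x => curl u x 0) p volume + eLpNorm (fun x => curl u x 1) p volume
    have hSm : ∀ i, AEStronglyMeasurable
        (fun x => (Torus.partialDeriv 2 u x i + Torus.partialDeriv i u x 2) / 2) volume := fun i =>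
      ((isSmooth_strainColumnTwice hu i).continuous.div_const 2).aestronglyMeasurable
    -- `vᵢ = vᵢ/2 + vᵢ/2`, each half bounded by `C₂ W`
    have hvi : ∀ i, eLpNorm (fun x => Torus.partialDeriv 2 u x i + Torus.partialDeriv i u x 2)
        p volume ≤ 2 * C₂ * W := by
      intro i
      have e : (fun x => Torus.partialDeriv 2 u x i + Torus.partialDeriv i u x 2) =
          (fun x => (Torus.partialDeriv 2 u x i + Torus.partialDeriv i u x 2) / 2) +
            fun x => (Torus.partialDeriv 2 u x i + Torus.partialDeriv i u x 2) / 2 := by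
        funext x; simp only [Pi.add_apply]; ring
      rw [e]
      calc eLpNorm ((fun x => (Torus.partialDeriv 2 u x i + Torus.partialDeriv i u x 2) / 2) +
            fun x => (Torus.partialDeriv 2 u x i + Torus.partialDeriv i u x 2) / 2) p volume
          ≤ eLpNorm (fun x => (Torus.partialDeriv 2 u x i + Torus.partialDeriv i u x 2) / 2) p volume +
              eLpNorm (fun x => (Torus.partialDeriv 2 u x i + Torus.partialDeriv i u x 2) / 2)
                p volume := eLpNorm_add_le (hSm i) (hSm i) hp1.le
        _ ≤ C₂ * W + C₂ * W := add_le_add (hC₂ u hu hdiv i) (hC₂ u hu hdiv i)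
        _ = 2 * C₂ * W := by ring
    calc ∑ j : Fin 3, eLpNorm (fun x => Torus.partialDeriv 2 u x j + Torus.partialDeriv j u x 2)
          p volume
        ≤ ∑ _j : Fin 3, 2 * C₂ * W := Finset.sum_le_sum fun j _ => hvi j
      _ = ((6 * C₂ : ℝ≥0) : ℝ≥0∞) * W := by
          rw [Finset.sum_const, Finset.card_univ, Fintype.card_fin]
          push_cast
          ring
      _ ≤ ((2 * C₁ + 6 * C₂ : ℝ≥0) : ℝ≥0∞) * W := by
          gcongr
          exact_mod_cast (le_add_of_nonneg_left (by positivity) : 6 * C₂ ≤ 2 * C₁ + 6 * C₂)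

end BDSV

end Literature.Analysis.FluidPDE

end
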